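import Summits.Ventures.QEC.Census.IPBounds.LaiAshikhmin28_14
import Literature.InformationTheory.QuantumCodes.SplitEnumeratorLPBounds
import HarnessLib

/-!
# Lai–Ashikhmin's two Table-III improvements — the named fact `LaiAshikhmin2018_no_27_15_5_and_no_28_14_6` DISCHARGED

Venture QEC (cell `qec`), row 06 / rung X1. `Literature/InformationTheory/QuantumCodes/SplitEnumeratorLPBounds.lean` carries
the named fact `LaiAshikhmin2018_no_27_15_5_and_no_28_14_6 : Prop := ¬ AdditiveCodeExists 27 15 5 ∧ ¬ AdditiveCodeExists 28 14 6`
[LaiAshikhmin2018, §5.2 Examples] (qec-lit-1). Both conjuncts are now KERNEL theorems of the census: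
`noCodeLA_27_15` (`IPBounds/LaiAshikhmin27_15.lean`: CRSS's plain LP forces `A`, the refined system of the pair `(C, C′)`
w.r.t. a codeword of weight `24` is integer-infeasible — one HNF congruence split and two Farkas pair leaves checked with the
transformed-table check `rleafOKQ`) and `noCodeLA_28_14` (`IPBounds/LaiAshikhmin28_14.lean`: weight-one shortening or purity by
five plain certificates + CRSS Thm. 6 (b)). This file records the discharge (pattern of `CRSSSpecialBoundsHolds.lean`; a
Literature file may not import Summits). HONEST FRAMING: nonexistence only (upper bounds); no distance of any code is certified.
[cite: LaiAshikhmin2018, §5.2 Examples «Nonexistence of [[27,15,5]] quantum codes», «Nonexistence of [[28,14,6]] quantum codes»;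
CalderbankEtAl1998, §7 (ii) and §8 Table III entries (27,15), (28,14)]
-/

namespace Summit.Ventures.QEC.Census

open Literature.InformationTheory.QuantumCodes

/-- **Lai–Ashikhmin's improvements `(27,15) → 4` and `(28,14) → 5` of CRSS Table III — the named fact
`LaiAshikhmin2018_no_27_15_5_and_no_28_14_6` DISCHARGED**: no `[[27,15,5]]` and no `[[28,14,6]]` additive code.
(proved, KERNEL, unconditional) [cite: LaiAshikhmin2018, §5.2 Examples; CalderbankEtAl1998, §8 Table III entries (27,15), (28,14)] -/
theorem LaiAshikhmin2018_no_27_15_5_and_no_28_14_6_holds : LaiAshikhmin2018_no_27_15_5_and_no_28_14_6 :=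
  ⟨noCodeLA_27_15, noCodeLA_28_14⟩

/-- The two cells in the table's `∀ d ≥ d₀` form: no `[[27,15,d]]` for `d ≥ 5` and no `[[28,14,d]]` for `d ≥ 6`.
(proved, KERNEL, unconditional) [cite: LaiAshikhmin2018, §5.2 Examples; CalderbankEtAl1998, §8 Table III entries (27,15), (28,14)] -/
theorem noCodeLA_of_le :
    (∀ d, 5 ≤ d → ¬ AdditiveCodeExists 27 15 d) ∧ (∀ d, 6 ≤ d → ¬ AdditiveCodeExists 28 14 d) :=
  ⟨fun _ hd => LaiAshikhmin2018_no_27_15_5_and_no_28_14_6.no_27_15 LaiAshikhmin2018_no_27_15_5_and_no_28_14_6_holds hd,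
    fun _ hd => LaiAshikhmin2018_no_27_15_5_and_no_28_14_6.no_28_14 LaiAshikhmin2018_no_27_15_5_and_no_28_14_6_holds hd⟩

end Summit.Ventures.QEC.Census
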